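import Literature.Probability.LatticeModels.PlaneRotatorPoissonCurrents
import Literature.Probability.LatticeModels.RivasseauDigraphLemma
import Literature.Probability.LatticeModels.PlaneRotatorLiebRivasseauInequality
import HarnessLib

/-!
# Plane-rotator character integrals as series over `ℕ`-currents with real Poisson weights

Topic `Literature/Probability/LatticeModels`. Real, `ℕ`-indexed form of the double Poisson-current expansion of
`PlaneRotatorPoissonCurrents.lean` (E. H. Lieb, Comm. Math. Phys. 77 (1980) 127–135 [Lieb1980], p. 133: "expanded
in a power series in `β` … directed graphs"): for pair couplings `J : V × V → ℝ` on ordered pairs,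

* `poissonWeight J T = ∏ₐ (Jₐ/2)^{Tₐ}/Tₐ!` — the weight of an `ℕ`-current `T : (V×V)×Bool → ℕ` (`Tₐ` arrows on the
  slot `a`; `poissonWeight_nonneg` for `J ≥ 0`); `Balances k T` — the valence constraint against integer vertex
  exponents `k` (`k_v + (arrows of T into v) − (arrows out of v) = 0`);
* `integral_monomialChar_mul_ginibreWeight_eq_tsum` / `integral_cosDiff_mul_ginibreWeight_eq_tsum` /
  `integral_ginibreWeight_eq_tsum_poissonWeight` — `∫ cos(θ_x − θ_y) e^{∑ J cos} dθ = ∑_{T balancing δ_y − δ_x} W_J(T)`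
  and `∫ e^{∑ J cos} dθ = ∑_{T balancing 0} W_J(T)` (series over `ℕ`-currents; `tsum_int_eq_tsum_nat`);
* `summable_poissonWeight` — summability of the constrained weights (`J ≥ 0`);
* `poissonWeight_mul_poissonWeight_sub` — the slotwise binomial identity `W(n) W(T−n) = W(T) ∏ₐ C(Tₐ, nₐ)` behind
  the regrouping of a product of two expansions by total multiplicity (Lieb p. 133 / Rivasseau's subgraph counts);
* `exponent_natCast_eq_mval` — the exponent of an `ℕ`-current is Rivasseau's multiplicity valence
  (`RivasseauDigraphLemma.lean`) with heads `arrowHead` and tails `arrowTail`.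

These are Step B(2,4,5) of the tree's plan to discharge the named fact `PlaneRotator.LiebRivasseauInequality`
(cell `pub/hubbard-tc`, INTERLAYER-v0.1.md §14); the assembly (products of the series, regrouping by
`T = n₁ + n₂`, Rivasseau's lemma termwise) is the remaining step.
-/

noncomputable section

open MeasureTheory Filter Finset
open scoped Topology BigOperators Nat

namespace Literature.Probability.LatticeModels

namespace PlaneRotator

variable {V : Type} [Fintype V] [DecidableEq V]

/-! ### Real Poisson weights of `ℕ`-currents -/

/-- The Poisson weight `∏ₐ (Jₐ/2)^{Tₐ}/Tₐ!` of an `ℕ`-current `T` (slot `a = (p, dir)` carries the coupling `J p`).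
[cite: Lieb1980, p. 133 (power series in β)] -/
def poissonWeight (J : V × V → ℝ) (T : (V × V) × Bool → ℕ) : ℝ :=
  ∏ a, (J a.1 / 2) ^ (T a) / ((T a)! : ℝ)

/-- The valence constraint of an `ℕ`-current against integer vertex exponents `k`. [cite: Lieb1980, p. 133] -/
def Balances (k : V → ℤ) (T : (V × V) × Bool → ℕ) : Prop :=
  ∀ v, k v + exponent (fun a => (T a : ℤ)) v = 0

/-- `Balances k T` is decidable (a finite conjunction of integer equalities). [folklore] -/
instance instDecidableBalances (k : V → ℤ) (T : (V × V) × Bool → ℕ) : Decidable (Balances k T) := by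
  unfold Balances; infer_instance

omit [DecidableEq V] in
/-- The Poisson weight is non-negative for `J ≥ 0`. [cite: Lieb1980, p. 133 (power series in β)] -/
theorem poissonWeight_nonneg {J : V × V → ℝ} (hJ : ∀ p, 0 ≤ J p) (T : (V × V) × Bool → ℕ) :
    0 ≤ poissonWeight J T :=
  Finset.prod_nonneg fun a _ => div_nonneg (pow_nonneg (by linarith [hJ a.1]) _) (Nat.cast_nonneg _)

omit [DecidableEq V] in
/-- The complex Poisson coefficients of an `ℕ`-current multiply to the real Poisson weight. [cite: Lieb1980, p. 133 (power series in β)] -/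
theorem prod_poissonCoeff_natCast (J : V × V → ℝ) (T : (V × V) × Bool → ℕ) :
    ∏ a, poissonCoeff (J a.1) (T a : ℤ) = ((poissonWeight J T : ℝ) : ℂ) := by
  unfold poissonWeight
  push_cast
  refine Finset.prod_congr rfl fun a _ => ?_
  rw [poissonCoeff_natCast]
  push_cast
  ring

omit [DecidableEq V] in
/-- A product of Poisson coefficients vanishes as soon as one index is negative. [cite: Lieb1980, p. 133 (power series in β)] -/
theorem prod_poissonCoeff_eq_zero_of_neg (J : V × V → ℝ) {n : (V × V) × Bool → ℤ} {a : (V × V) × Bool}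
    (ha : n a < 0) : ∏ b, poissonCoeff (J b.1) (n b) = 0 :=
  Finset.prod_eq_zero (Finset.mem_univ a) (poissonCoeff_of_neg _ ha)

/-- `ℕ`-currents are the non-negative `ℤ`-currents. [folklore] -/
def natCurrentEquiv (ι : Type*) : (ι → ℕ) ≃ ({n : ι → ℤ | ∀ a, 0 ≤ n a} : Set (ι → ℤ)) where
  toFun T := ⟨fun a => (T a : ℤ), fun a => Int.natCast_nonneg _⟩
  invFun n := fun a => (n.1 a).toNat
  left_inv T := funext fun a => by simp
  right_inv n := Subtype.ext (funext fun a => Int.toNat_of_nonneg (n.2 a))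

/-- A series over `ℤ`-currents supported on the non-negative cone is a series over `ℕ`-currents. [folklore] -/
private theorem tsum_int_eq_tsum_nat {ι : Type*} {f : (ι → ℤ) → ℂ} (hf : ∀ n : ι → ℤ, (∃ a, n a < 0) → f n = 0) :
    ∑' n, f n = ∑' T : ι → ℕ, f (fun a => (T a : ℤ)) := by
  have hsupp : Function.support f ⊆ ({n : ι → ℤ | ∀ a, 0 ≤ n a} : Set (ι → ℤ)) := by
    intro n hn
    by_contra h
    simp only [Set.mem_setOf_eq, not_forall, not_le] at h
    exact hn (hf n h)
  rw [← tsum_subtype_eq_of_support_subset hsupp]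
  exact (Equiv.tsum_eq (natCurrentEquiv ι) (fun x => f x.1)).symm

variable [MeasurableSpace Circle] [BorelSpace Circle]

/-- **Expansion in `ℕ`-currents (complex form).** For any `J` and integer exponents `k`:
`∫ (∏_v θ_v^{k_v}) e^{∑ J cos} dθ = ∑_{T : ℕ-currents balancing k} W_J(T)`. [cite: Lieb1980, p. 133 (power series in β; directed graphs)] -/
theorem integral_monomialChar_mul_ginibreWeight_eq_tsum (J : V × V → ℝ) (k : V → ℤ) :
    ∫ θ, ((monomialChar k θ : Circle) : ℂ) * (ginibreWeight (pairChars V) J θ : ℂ) ∂torusHaar V =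
      ∑' T : (V × V) × Bool → ℕ, if Balances k T then ((poissonWeight J T : ℝ) : ℂ) else 0 := by
  rw [integral_coe_char_mul_ginibreWeight_eq_tsum_poisson J (monomialChar k)]
  rw [tsum_int_eq_tsum_nat]
  · refine tsum_congr fun T => ?_
    have hiff := twistChar_poissonChars_eq_one_iff k (fun a => (T a : ℤ))
    by_cases hB : Balances k T
    · rw [if_pos (hiff.2 hB), if_pos hB, prod_poissonCoeff_natCast]
    · rw [if_neg (fun h => hB (hiff.1 h)), if_neg hB]
  · rintro n ⟨a, ha⟩
    split_ifs
    · exact prod_poissonCoeff_eq_zero_of_neg J ha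
    · rfl

/-- **Two-point numerator as a series over `ℕ`-currents.** `∫ cos(θ_x − θ_y)·e^{∑J cos} dθ = ∑_{T : ℕ-currents balancing δ_y − δ_x} W_J(T)`. [cite: Lieb1980, p. 133 (power series in β; directed graphs)] -/
theorem integral_cosDiff_mul_ginibreWeight_eq_tsum (J : V × V → ℝ) (x y : V) :
    ∫ θ, cosDiff x y θ * ginibreWeight (pairChars V) J θ ∂torusHaar V =
      ∑' T : (V × V) × Bool → ℕ,
        if Balances ((Pi.single y (1 : ℤ) : V → ℤ) - Pi.single x 1) T then poissonWeight J T else 0 := by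
  set k : V → ℤ := (Pi.single y (1 : ℤ) : V → ℤ) - Pi.single x 1 with hk
  have hC := integral_monomialChar_mul_ginibreWeight_eq_tsum J k
  rw [← diffChar_eq_monomialChar] at hC
  -- the complex series is the real series
  have hsum : (∑' T : (V × V) × Bool → ℕ, if Balances k T then ((poissonWeight J T : ℝ) : ℂ) else 0) =
      (((∑' T : (V × V) × Bool → ℕ, if Balances k T then poissonWeight J T else 0 : ℝ)) : ℂ) := by
    rw [Complex.ofReal_tsum]
    refine tsum_congr fun T => ?_
    split_ifs <;> simp
  rw [hsum] at hC
  -- real parts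
  have hint : Integrable (fun θ => ((diffChar x y θ : Circle) : ℂ) * (ginibreWeight (pairChars V) J θ : ℂ))
      (torusHaar V) :=
    integrable_torusHaar_of_continuous ((continuous_subtype_val.comp (diffChar x y).continuous).mul
      (Complex.continuous_ofReal.comp (continuous_ginibreWeight _ _)))
  have hre := integral_re hint
  rw [hC] at hre
  simp only [RCLike.re_to_complex, Complex.ofReal_re] at hre
  rw [← hre]
  refine integral_congr_ae (ae_of_all _ fun θ => ?_)
  dsimp only
  rw [Complex.mul_re, Complex.ofReal_re, Complex.ofReal_im, mul_zero, sub_zero, cosDiff_eq_reChar]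
  rfl

/-- **Partition function as a series over `ℕ`-currents.** `∫ e^{∑J cos} dθ = ∑_{T balancing 0} W_J(T)`. [cite: Lieb1980, p. 133 (power series in β; directed graphs)] -/
theorem integral_ginibreWeight_eq_tsum_poissonWeight (J : V × V → ℝ) [Nonempty V] :
    ∫ θ, ginibreWeight (pairChars V) J θ ∂torusHaar V =
      ∑' T : (V × V) × Bool → ℕ, if Balances 0 T then poissonWeight J T else 0 := by
  obtain ⟨x⟩ := ‹Nonempty V›
  have h := integral_cosDiff_mul_ginibreWeight_eq_tsum J x x
  rw [sub_self] at h
  rw [← h]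
  refine integral_congr_ae (ae_of_all _ fun θ => ?_)
  have h1 : cosDiff x x θ = 1 := by
    rw [cosDiff, ← Complex.normSq_eq_conj_mul_self, Complex.ofReal_re, Circle.normSq_coe]
  dsimp only
  rw [h1, one_mul]

omit [MeasurableSpace Circle] [BorelSpace Circle] in
/-- Summability of the constrained Poisson weights (`J ≥ 0`). [cite: Lieb1980, p. 133 (power series in β)] -/
theorem summable_poissonWeight {J : V × V → ℝ} (hJ : ∀ p, 0 ≤ J p) (P : ((V × V) × Bool → ℕ) → Prop)
    [DecidablePred P] : Summable fun T : (V × V) × Bool → ℕ => if P T then poissonWeight J T else 0 := by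
  classical
  -- the unconstrained weights are summable: restriction of the `ℤ`-indexed absolutely summable coefficients
  have hZ : Summable fun n : (V × V) × Bool → ℤ => ∏ a, ‖poissonCoeff (J a.1) (n a)‖ :=
    summable_prod_norm fun a => summable_norm_poissonCoeff (J a.1)
  have hinj : Function.Injective fun (T : (V × V) × Bool → ℕ) (a : (V × V) × Bool) => (T a : ℤ) :=
    fun T T' h => funext fun a => by
      have h' : (T a : ℤ) = (T' a : ℤ) := congrFun h a
      exact_mod_cast h'
  have hN := hZ.comp_injective hinj
  have hW : ∀ T : (V × V) × Bool → ℕ, (∏ a, ‖poissonCoeff (J a.1) ((T a : ℕ) : ℤ)‖) = poissonWeight J T := by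
    intro T
    rw [← Complex.norm_prod, prod_poissonCoeff_natCast, Complex.norm_real, Real.norm_of_nonneg (poissonWeight_nonneg hJ T)]
  refine Summable.of_nonneg_of_le (fun T => ?_) (fun T => ?_) (hN.congr fun T => hW T)
  · split_ifs; exacts [poissonWeight_nonneg hJ T, le_rfl]
  · split_ifs; exacts [le_rfl, poissonWeight_nonneg hJ T]

omit [DecidableEq V] [MeasurableSpace Circle] [BorelSpace Circle] in
/-- **Slotwise binomial identity** `W(n) W(T − n) = W(T) ∏ₐ C(Tₐ, nₐ)` for `n ≤ T`: two independent Poisson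
currents with total `T` are `∏ C(Tₐ, nₐ)` ways of choosing a sub-multiset of `T` distinguishable arrows (the
regrouping behind Lieb's "subgraphs of G"). [cite: Lieb1980, p. 133 (subgraphs (subsets of edges) of the directed graph)] -/
theorem poissonWeight_mul_poissonWeight_sub (J : V × V → ℝ) {T n : (V × V) × Bool → ℕ} (hn : n ≤ T) :
    poissonWeight J n * poissonWeight J (T - n) = poissonWeight J T * ∏ a, ((T a).choose (n a) : ℝ) := by
  unfold poissonWeight
  rw [← Finset.prod_mul_distrib, ← Finset.prod_mul_distrib]
  refine Finset.prod_congr rfl fun a _ => ?_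
  have hle : n a ≤ T a := hn a
  rw [Pi.sub_apply]
  have hfac : ((T a).choose (n a) : ℝ) * ((n a)! : ℝ) * ((T a - n a)! : ℝ) = ((T a)! : ℝ) := by
    exact_mod_cast Nat.choose_mul_factorial_mul_factorial hle
  have h1 : ((n a)! : ℝ) ≠ 0 := by positivity
  have h2 : ((T a - n a)! : ℝ) ≠ 0 := by positivity
  have h3 : ((T a)! : ℝ) ≠ 0 := by positivity
  rw [div_mul_div_comm, ← pow_add, Nat.add_sub_cancel' hle, div_mul_eq_mul_div, div_eq_div_iff (mul_ne_zero h1 h2) h3,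
    ← hfac]
  ring

omit [MeasurableSpace Circle] [BorelSpace Circle] in
/-- The exponent of an `ℕ`-current (arrows in minus arrows out, `PlaneRotatorPoissonCurrents.exponent`) is
Rivasseau's multiplicity valence `Rivasseau.mval` with heads `arrowHead` and tails `arrowTail`. [cite: Rivasseau1980, Lemma (p. 146) (valence = arrows in minus arrows out)] -/
theorem exponent_natCast_eq_mval (T : (V × V) × Bool → ℕ) (v : V) :
    exponent (fun a => (T a : ℤ)) v = Rivasseau.mval arrowHead arrowTail T v := by
  simp only [exponent, Rivasseau.mval, Finset.sum_filter, ← Finset.sum_sub_distrib]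
  refine Finset.sum_congr rfl fun a _ => ?_
  by_cases h1 : arrowHead a = v <;> by_cases h2 : arrowTail a = v <;>
    simp [h1, h2, eq_comm (a := v)]

end PlaneRotator

end Literature.Probability.LatticeModels

end
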